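import Summits.Ventures.DiscreteObjects.Hadamard.Order167InvertingIsInvolution668
import Summits.Ventures.DiscreteObjects.Hadamard.Order167CentralizerAbelian668

/-!
# H(668): the normaliser of an element of order 167 modulo `⟨σ⟩` is an ELEMENTARY ABELIAN 2-group — inverting elements
# commute with centralising involutions, conjugation by an inverting element fixes every centralising class, every square
# lies in `⟨σ⟩` (kernel)

Framing: lottery ticket; floor = certified bounds/negative ranges.

Cell pub-namedobj (venture DiscreteObjects), target (H), hadamard gen 22.  `σ = (π, κ, d, e)` a signed automorphism of pair
order `167` of a Hadamard matrix of order `668`; `N = N(⟨σ⟩)`, `C = C(σ)` at the pair level.  Known: `C` is abelian with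
`C/⟨σ⟩` of exponent `2` and `|C : ±⟨σ⟩| ≤ 4` (gen 21), `N/C ≤ C₂` (gen 21), every element of `N ∖ C` is a pair-involution (gen 22,
`Order167InvertingIsInvolution668`).  Here the remaining commutation relations:
* **`hadamard668_order167_inverting_commute_involution`**: an inverting `ρ` COMMUTES (pairs) with every centralising
  involution-or-trivial `τ` [`ρτ` inverts `σ`, hence is a pair-involution; three involutions `ρ, τ, ρτ`].
* **`hadamard668_order167_inverting_conj_centralizing`**: for an inverting `ρ` and ANY centralising `α`:
  `ρ α ρ = α σ^{166c}` where `α² = σ^c` — conjugation by `ρ` fixes every class of `C/⟨σ⟩` [`α σ^{83c}` is a centralising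
  involution-or-trivial pair, so it commutes with `ρ`; `ρ σ^{83c} ρ = σ^{-83c}`].
* **`hadamard668_order167_normalizer_sq_mem`**: EVERY element of `N` (any multiplier) squares into `⟨σ⟩`:
  `(π'², κ'²) = (π^c, κ^c)` [centralising: gen 21; inverting: `c = 0`, gen 22].
* **`hadamard668_order167_inverting_mul_inverting`**: two inverting elements commute modulo `⟨σ⟩`:
  `ρ₁ρ₂ρ₁ρ₂ = (ρ₁ρ₂)² ∈ ⟨σ⟩`.
WORDS (paper step = bookkeeping on these kernel facts): `N(⟨σ₁₆₇⟩)/⟨σ₁₆₇⟩` is abelian of exponent `2`, i.e. **an elementary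
abelian 2-group, of order `2, 4, 8` or `16` at the pair level (`±` included: `N/±⟨σ⟩` of order `1, 2, 4, 8`)**, the top case
`8` being exactly the classical Williamson matrices (`Order167WilliamsonSymmetric668`).  STRUCTURE of a hypothetical object; no
Hadamard order excluded; H(668) untouched; HITS 0/4.  Ours; no `sorry`, no definitions, default heartbeats.
-/

namespace Summit.Ventures.DiscreteObjects.Hadamard

open Finset BigOperators Matrix

open Literature.Combinatorics.Designs.GoethalsSeidel (IsHadamardMatrix)

variable {ι : Type*} [Fintype ι] [DecidableEq ι]

section main
variable {H : Matrix ι ι ℤ} (hH : IsHadamardMatrix H) (hι : Fintype.card ι = 668)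
  {π κ π' κ' : Equiv.Perm ι} {d e d' e' : ι → ℤ} (haut : IsSignedAut H π κ d e)
  (hπ : π ^ 167 = 1) (hκ : κ ^ 167 = 1) (hne : π ≠ 1 ∨ κ ≠ 1)
  (haut' : IsSignedAut H π' κ' d' e') {μ : ℕ} (hnπ : π' * π = π ^ μ * π') (hnκ : κ' * κ = κ ^ μ * κ')
include hH hι haut hπ hκ hne haut' hnπ hnκ

/-- **An inverting element commutes (pairs) with every centralising involution-or-trivial element.** -/
theorem hadamard668_order167_inverting_commute_involution (hμ : μ % 167 = 166) {π₁ κ₁ : Equiv.Perm ι} {d₁ e₁ : ι → ℤ}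
    (h₁ : IsSignedAut H π₁ κ₁ d₁ e₁) (hc₁ : Commute π₁ π) (hc₁' : Commute κ₁ κ) (hi₁ : π₁ ^ 2 = 1) (hi₁' : κ₁ ^ 2 = 1) :
    Commute π' π₁ ∧ Commute κ' κ₁ := by
  obtain ⟨h2, h2'⟩ := hadamard668_order167_inverting_sq_eq_one hH hι haut hπ hκ hne haut' hnπ hnκ hμ
  have hn₁ : π₁ * π = π ^ 1 * π₁ := by rw [pow_one]; exact hc₁.eq
  have hn₁' : κ₁ * κ = κ ^ 1 * κ₁ := by rw [pow_one]; exact hc₁'.eq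
  have hnψ : (π' * π₁) * π = π ^ μ * (π' * π₁) := by have h := norm_mul hnπ hn₁; rwa [mul_one] at h
  have hnψ' : (κ' * κ₁) * κ = κ ^ μ * (κ' * κ₁) := by have h := norm_mul hnκ hn₁'; rwa [mul_one] at h
  obtain ⟨hs, hs'⟩ := hadamard668_order167_inverting_sq_eq_one hH hι haut hπ hκ hne (isSignedAut_mul haut' h₁) hnψ hnψ' hμ
  exact ⟨commute_of_three_squares h2 hi₁ hs, commute_of_three_squares h2' hi₁' hs'⟩

/-- **Conjugation by an inverting element fixes every centralising class modulo `⟨σ⟩`:** if `α` centralises `σ` with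
`α² = σ^c` then `ρ α ρ = α σ^(166 c)` (pairs; `ρ² = 1`). -/
theorem hadamard668_order167_inverting_conj_centralizing (hμ : μ % 167 = 166) {α α' : Equiv.Perm ι} {dα eα : ι → ℤ}
    (hA : IsSignedAut H α α' dα eα) (hcα : Commute α π) (hcα' : Commute α' κ) :
    ∃ c : ℕ, α ^ 2 = π ^ c ∧ α' ^ 2 = κ ^ c ∧ π' * α * π' = α * π ^ (166 * c) ∧ κ' * α' * κ' = α' * κ ^ (166 * c) := by
  obtain ⟨c, hc, hc'⟩ := hadamard668_order167_centralizer_sq_mem hH hι haut hπ hκ hne hA hcα hcα'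
  obtain ⟨h2, h2'⟩ := hadamard668_order167_inverting_sq_eq_one hH hι haut hπ hκ hne haut' hnπ hnκ hμ
  -- τ := α σ^{83 c} is a centralising involution-or-trivial pair
  have hT := isSignedAut_mul hA (isSignedAut_pow haut (83 * c))
  have hcT : Commute (α * π ^ (83 * c)) π := hcα.mul_left (Commute.pow_left (Commute.refl π) _)
  have hcT' : Commute (α' * κ ^ (83 * c)) κ := hcα'.mul_left (Commute.pow_left (Commute.refl κ) _)
  have hiT : (α * π ^ (83 * c)) ^ 2 = 1 := by
    rw [(hcα.pow_right (83 * c)).mul_pow, hc, ← pow_mul, ← pow_add, show c + 83 * c * 2 = 167 * c by ring, pow_mul, hπ,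
      one_pow]
  have hiT' : (α' * κ ^ (83 * c)) ^ 2 = 1 := by
    rw [(hcα'.pow_right (83 * c)).mul_pow, hc', ← pow_mul, ← pow_add, show c + 83 * c * 2 = 167 * c by ring, pow_mul, hκ,
      one_pow]
  obtain ⟨hcm, hcm'⟩ := hadamard668_order167_inverting_commute_involution hH hι haut hπ hκ hne haut' hnπ hnκ hμ hT hcT
    hcT' hiT hiT'
  refine ⟨c, hc, hc', ?_, ?_⟩
  · -- π' α π' = (π' (α π^{83c}) π') π'⁻¹ π^{-83c}… : use the commutation and ρ σ^{83c} ρ = σ^{83 c μ}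
    have h83 : π ^ (83 * c) * π ^ (84 * c) = 1 := by
      rw [← pow_add, show 83 * c + 84 * c = 167 * c by ring, pow_mul, hπ, one_pow]
    have hρρ : π' * π' = 1 := by rw [← pow_two, h2]
    have h166 : π ^ (166 * c) = π ^ (83 * c) * π ^ (83 * c) := by rw [← pow_add]; ring_nf
    -- α = τ π^{84c}
    have hα : α = (α * π ^ (83 * c)) * π ^ (84 * c) := by rw [mul_assoc, h83, mul_one]
    calc π' * α * π' = π' * ((α * π ^ (83 * c)) * π ^ (84 * c)) * π' := by rw [← hα]
      _ = (α * π ^ (83 * c)) * (π' * π ^ (84 * c) * π') := by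
          rw [← mul_assoc π', hcm.eq]; simp only [mul_assoc]
      _ = α * π ^ (166 * c) := by
          have hconj' : π' * π ^ (84 * c) = π ^ (μ * (84 * c)) * π' := norm_comm_pow hnπ (84 * c)
          have hμc' : π ^ (μ * (84 * c)) = π ^ (83 * c) := by
            apply pow_eq_pow_of_natCast_eq_n hπ
            have hμ' : (μ : ZMod 167) = -1 := by rw [← ZMod.natCast_mod μ 167, hμ]; exact zmod167_166
            push_cast
            rw [hμ']
            have h167 : (167 : ZMod 167) = 0 := by decide
            linear_combination (-(c : ZMod 167)) * h167
          rw [hconj', hμc', mul_assoc (π ^ (83 * c)) π' π', hρρ, mul_one, mul_assoc, h166]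
  · have h83 : κ ^ (83 * c) * κ ^ (84 * c) = 1 := by
      rw [← pow_add, show 83 * c + 84 * c = 167 * c by ring, pow_mul, hκ, one_pow]
    have hρρ : κ' * κ' = 1 := by rw [← pow_two, h2']
    have h166 : κ ^ (166 * c) = κ ^ (83 * c) * κ ^ (83 * c) := by rw [← pow_add]; ring_nf
    have hα : α' = (α' * κ ^ (83 * c)) * κ ^ (84 * c) := by rw [mul_assoc, h83, mul_one]
    calc κ' * α' * κ' = κ' * ((α' * κ ^ (83 * c)) * κ ^ (84 * c)) * κ' := by rw [← hα]
      _ = (α' * κ ^ (83 * c)) * (κ' * κ ^ (84 * c) * κ') := by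
          rw [← mul_assoc κ', hcm'.eq]; simp only [mul_assoc]
      _ = α' * κ ^ (166 * c) := by
          have hconj' : κ' * κ ^ (84 * c) = κ ^ (μ * (84 * c)) * κ' := norm_comm_pow hnκ (84 * c)
          have hμc' : κ ^ (μ * (84 * c)) = κ ^ (83 * c) := by
            apply pow_eq_pow_of_natCast_eq_n hκ
            have hμ' : (μ : ZMod 167) = -1 := by rw [← ZMod.natCast_mod μ 167, hμ]; exact zmod167_166
            push_cast
            rw [hμ']
            have h167 : (167 : ZMod 167) = 0 := by decide
            linear_combination (-(c : ZMod 167)) * h167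
          rw [hconj', hμc', mul_assoc (κ ^ (83 * c)) κ' κ', hρρ, mul_one, mul_assoc, h166]

omit hnκ in
/-- **Every element of the normaliser squares into `⟨σ⟩`** (any multiplier): `(π'², κ'²) = (π^c, κ^c)`. -/
theorem hadamard668_order167_normalizer_sq_mem (hnκ : κ' * κ = κ ^ μ * κ') : ∃ c : ℕ, π' ^ 2 = π ^ c ∧ κ' ^ 2 = κ ^ c := by
  rcases hadamard668_order167_normalizer_dichotomy hH hι haut hπ hκ hne haut' hnπ hnκ with ⟨hc, hc'⟩ | hμ'
  · exact hadamard668_order167_centralizer_sq_mem hH hι haut hπ hκ hne haut' hc hc'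
  · have hμ : μ % 167 = 166 := by
      rw [← zmod167_166, ZMod.natCast_eq_natCast_iff'] at hμ'
      simpa using hμ'
    obtain ⟨h2, h2'⟩ := hadamard668_order167_inverting_sq_eq_one hH hι haut hπ hκ hne haut' hnπ hnκ hμ
    exact ⟨0, by rw [h2, pow_zero], by rw [h2', pow_zero]⟩

/-- **Two inverting elements commute modulo `⟨σ⟩`:** `ρ₁ ρ₂ ρ₁ ρ₂ ∈ ⟨σ⟩` (both are involutions and `ρ₁ρ₂` centralises). -/
theorem hadamard668_order167_inverting_mul_inverting (hμ : μ % 167 = 166) {π₂ κ₂ : Equiv.Perm ι} {d₂ e₂ : ι → ℤ}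
    (h₂ : IsSignedAut H π₂ κ₂ d₂ e₂) {μ₂ : ℕ} (hn₂ : π₂ * π = π ^ μ₂ * π₂) (hn₂' : κ₂ * κ = κ ^ μ₂ * κ₂)
    (hμ₂ : μ₂ % 167 = 166) :
    ∃ c : ℕ, π' * π₂ * π' * π₂ = π ^ c ∧ κ' * κ₂ * κ' * κ₂ = κ ^ c := by
  have hμμ : (μ : ZMod 167) = (μ₂ : ZMod 167) := by
    rw [← ZMod.natCast_mod μ 167, ← ZMod.natCast_mod μ₂ 167, hμ, hμ₂]
  obtain ⟨hc, hc'⟩ := hadamard668_order167_normalizer_mul_centralizes' hH hι haut hπ hκ hne h₂ hnπ hnκ hn₂ hn₂' hμμ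
  obtain ⟨c, h1, h1'⟩ := hadamard668_order167_centralizer_sq_mem hH hι haut hπ hκ hne (isSignedAut_mul haut' h₂) hc hc'
  refine ⟨c, ?_, ?_⟩
  · rw [← h1, pow_two]; simp only [mul_assoc]
  · rw [← h1', pow_two]; simp only [mul_assoc]

end main

end Summit.Ventures.DiscreteObjects.Hadamard
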